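import Summits.HubbardSuperconductivity.HubbardSuperconductivity.Theorems.WeakCouplingBCSWcbcsSsbToTorusLROWindowLatticeSums

/-!
# Stub `stub_softWindowTail_of_shape` of line `birth`
# (crux `InfraredCompletion`, item stmt-HubbardSuperconductivity-1321, route BcsKacWindow)

Pure 2-d lattice arithmetic, no physics: on the discrete torus `(ℤ/Lℤ)²`, for any Fock vector `ψ`,
any `A ≥ 0` and any window radius `ε > 0`, the POINTWISE relative Goldstone shape
`S_ψ(m) · |q_m| · L² ≤ A · S_ψ(0)` at every nonzero label `m` with `|q_m|² ≤ ε²` sums to the relative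
TAIL bound `Σ_{m ≠ 0, |q_m|² ≤ ε²} S_ψ(m) ≤ 2Aε · S_ψ(0)`.

Here `S_ψ(m) = pairStructureFactor dWaveFormFactor L ψ m = ‖Δ_d(m)ψ‖²/L² ≥ 0` and
`|q_m|² = momentumNormSq L m` (`PairFieldMomentum`). Proof: for `m ≠ 0` one has `|q_m| > 0`
(`momentumNormSq_eq_zero_iff`), so the shape gives `S_ψ(m) ≤ (A S_ψ(0)/L²) · |q_m|⁻¹`; the window
`|q_m|² ≤ ε²` lies in the strict window `|q_m|² < (2ε)²`, on which the landed lattice sum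
`latWindowSum_le` (crux `WcbcsSsbToTorusLRO`, stub LAT) gives `Σ_{m ≠ 0} |q_m|⁻¹ ≤ 2ε L²`.
Everything is folklore (the lattice-sum bookkeeping of any infrared-bound argument,
Kennedy–Lieb–Shastry, PRL 61 (1988) 2582); no definition is introduced.
-/

noncomputable section

-- the mandated namespace `Summit.<Summit>.<Problem>.Theorems…` repeats `HubbardSuperconductivity`
-- (single-problem summit, D-0017), which the `dupNamespace` linter flags on every declaration
set_option linter.dupNamespace false

namespace Summit.HubbardSuperconductivity.HubbardSuperconductivity.Theorems.InfraredCompletion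

open Literature.MathematicalPhysics.QuantumLattice Literature.Probability.LatticeModels
open Summit.HubbardSuperconductivity.HubbardSuperconductivity.Theorems.WcbcsSsbToTorusLRO
  (latWindowSum_le)

/-- **Pointwise step.** If `m ≠ 0` and `S_ψ(m) · |q_m| · L² ≤ A · S_ψ(0)`, then
`S_ψ(m) ≤ (A · S_ψ(0) / L²) · |q_m|⁻¹` (`|q_m| > 0` for `m ≠ 0`, `momentumNormSq_eq_zero_iff`).
[folklore] -/
theorem pairStructureFactor_le_of_shape {L : ℕ} [NeZero L] (ψ : Fock (Orb (FermionTorus 2 L)))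
    (A : ℝ) {m : Fin 2 → ZMod L} (hm : m ≠ 0)
    (h : pairStructureFactor dWaveFormFactor L ψ m * Real.sqrt (momentumNormSq L m) * (L : ℝ) ^ 2 ≤
      A * pairStructureFactor dWaveFormFactor L ψ 0) :
    pairStructureFactor dWaveFormFactor L ψ m ≤
      A * pairStructureFactor dWaveFormFactor L ψ 0 / (L : ℝ) ^ 2 *
        (1 / Real.sqrt (momentumNormSq L m)) := by
  have hL : (0 : ℝ) < (L : ℝ) := Nat.cast_pos.2 (Nat.pos_of_ne_zero (NeZero.ne L))
  have hL2 : (0 : ℝ) < (L : ℝ) ^ 2 := by positivity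
  have hq : 0 < momentumNormSq L m :=
    lt_of_le_of_ne (momentumNormSq_nonneg m)
      (fun h0 => hm ((momentumNormSq_eq_zero_iff m).1 h0.symm))
  have hsq : 0 < Real.sqrt (momentumNormSq L m) := Real.sqrt_pos.2 hq
  rw [mul_one_div, le_div_iff₀ hsq, le_div_iff₀ hL2]
  exact h

/-- **Window inclusion.** The closed window `|q_m|² ≤ ε²` of nonzero labels lies in the strict
window `|q_m|² < (2ε)²` (`ε > 0`). [folklore] -/
theorem filter_window_subset_strict {L : ℕ} [NeZero L] (ε : ℝ) (hε : 0 < ε) :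
    Finset.univ.filter (fun m : Fin 2 → ZMod L => m ≠ 0 ∧ momentumNormSq L m ≤ ε ^ 2) ⊆
      Finset.univ.filter (fun m : TorusSite 2 L => m ≠ 0 ∧ momentumNormSq L m < (2 * ε) ^ 2) := by
  intro m hm
  obtain ⟨hm0, hmε⟩ := (Finset.mem_filter.1 hm).2
  refine Finset.mem_filter.2 ⟨Finset.mem_univ _, hm0, lt_of_le_of_lt hmε ?_⟩
  nlinarith

/-- **Stub B1 — `stub_softWindowTail_of_shape` (line `birth`, crux `InfraredCompletion`,
stmt-HubbardSuperconductivity-1321): the pointwise relative Goldstone shape sums to the relative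
tail bound.** For every side `L ≥ 1`, every Fock vector `ψ`, every `A ≥ 0` and every window radius
`ε > 0`: if `S_ψ(m) · |q_m| · L² ≤ A · S_ψ(0)` for all `m ≠ 0` with `|q_m|² ≤ ε²`, then
`Σ_{m ≠ 0, |q_m|² ≤ ε²} S_ψ(m) ≤ 2Aε · S_ψ(0)`. Proof: sum the pointwise step and use
`Σ_{0 < |q_m| < 2ε} |q_m|⁻¹ ≤ 2ε L²` (`latWindowSum_le`). Pure lattice arithmetic, any vector, no
physics. Kennedy–Lieb–Shastry, PRL 61 (1988) 2582 (lattice-sum bookkeeping of the infrared bound).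
[folklore] -/
theorem stub_softWindowTail_of_shape :
    ∀ (L : ℕ) [NeZero L] (ψ : Fock (Orb (FermionTorus 2 L))) (A ε : ℝ), 0 ≤ A → 0 < ε →
      (∀ m : Fin 2 → ZMod L, m ≠ 0 → momentumNormSq L m ≤ ε ^ 2 →
        pairStructureFactor dWaveFormFactor L ψ m * Real.sqrt (momentumNormSq L m) * (L : ℝ) ^ 2 ≤
          A * pairStructureFactor dWaveFormFactor L ψ 0) →
      ∑ m ∈ Finset.univ.filter
          (fun m : Fin 2 → ZMod L => m ≠ 0 ∧ momentumNormSq L m ≤ ε ^ 2),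
        pairStructureFactor dWaveFormFactor L ψ m ≤
      2 * A * ε * pairStructureFactor dWaveFormFactor L ψ 0 := by
  intro L _ ψ A ε hA hε hshape
  have hL : (0 : ℝ) < (L : ℝ) := Nat.cast_pos.2 (Nat.pos_of_ne_zero (NeZero.ne L))
  have hL2 : (0 : ℝ) < (L : ℝ) ^ 2 := by positivity
  have hS0 : 0 ≤ pairStructureFactor dWaveFormFactor L ψ 0 := pairStructureFactor_nonneg _ _ _ _
  have hK : 0 ≤ A * pairStructureFactor dWaveFormFactor L ψ 0 / (L : ℝ) ^ 2 :=
    div_nonneg (mul_nonneg hA hS0) hL2.le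
  have hpt : ∀ m ∈ Finset.univ.filter
      (fun m : Fin 2 → ZMod L => m ≠ 0 ∧ momentumNormSq L m ≤ ε ^ 2),
      pairStructureFactor dWaveFormFactor L ψ m ≤
        A * pairStructureFactor dWaveFormFactor L ψ 0 / (L : ℝ) ^ 2 *
          (1 / Real.sqrt (momentumNormSq L m)) := by
    intro m hm
    obtain ⟨hm0, hmε⟩ := (Finset.mem_filter.1 hm).2
    exact pairStructureFactor_le_of_shape ψ A hm0 (hshape m hm0 hmε)
  have h2ε : 0 < 2 * ε := by positivity
  calc ∑ m ∈ Finset.univ.filter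
          (fun m : Fin 2 → ZMod L => m ≠ 0 ∧ momentumNormSq L m ≤ ε ^ 2),
          pairStructureFactor dWaveFormFactor L ψ m
      ≤ ∑ m ∈ Finset.univ.filter
          (fun m : Fin 2 → ZMod L => m ≠ 0 ∧ momentumNormSq L m ≤ ε ^ 2),
          A * pairStructureFactor dWaveFormFactor L ψ 0 / (L : ℝ) ^ 2 *
            (1 / Real.sqrt (momentumNormSq L m)) := Finset.sum_le_sum hpt
    _ = A * pairStructureFactor dWaveFormFactor L ψ 0 / (L : ℝ) ^ 2 *
          ∑ m ∈ Finset.univ.filter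
            (fun m : Fin 2 → ZMod L => m ≠ 0 ∧ momentumNormSq L m ≤ ε ^ 2),
            1 / Real.sqrt (momentumNormSq L m) := by rw [Finset.mul_sum]
    _ ≤ A * pairStructureFactor dWaveFormFactor L ψ 0 / (L : ℝ) ^ 2 *
          ∑ m ∈ Finset.univ.filter
            (fun m : TorusSite 2 L => m ≠ 0 ∧ momentumNormSq L m < (2 * ε) ^ 2),
            1 / Real.sqrt (momentumNormSq L m) := by
        refine mul_le_mul_of_nonneg_left ?_ hK
        exact Finset.sum_le_sum_of_subset_of_nonneg (filter_window_subset_strict ε hε)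
          (fun m _ _ => by positivity)
    _ ≤ A * pairStructureFactor dWaveFormFactor L ψ 0 / (L : ℝ) ^ 2 * ((2 * ε) * (L : ℝ) ^ 2) :=
        mul_le_mul_of_nonneg_left (latWindowSum_le L (2 * ε) h2ε) hK
    _ = 2 * A * ε * pairStructureFactor dWaveFormFactor L ψ 0 := by
        field_simp

end Summit.HubbardSuperconductivity.HubbardSuperconductivity.Theorems.InfraredCompletion

end
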